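import Summits.QuantumFields.QCD.Theorems.HeatSlicedQuarksSmallFieldUltracontractivityStubCombGauge

/-!
# Stub `stub_globalCombGauge` of line `Sketch`
(crux `Summit.QuantumFields.QCD.Theses.HeatSlicedQuarks.InterleavedHeatSliceFlow`, item stmt-QuantumFields-8891)

**Global comb gauge** (reshape r4, the statement `GlobalCombGauge` consumed by
`stub_interiorAssembly`).  There are `C_A ≥ 0` and `A₀` such that on an `L⁴` torus of side
`L ≥ A₀/δ` (`0 < δ ≤ 1`), global `δ²`-smallness of the `SU(3)` plaquette deficits
`3 − Re tr U_p ≤ δ²` gives a gauge `g` in which EVERY link has deficit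
`3 − Re tr (g • U)(z, μ) ≤ C_A (torusDist x z + 1)² δ²`.

Proof.  Take the constant `C_A` of 8871's landed comb gauge `stub_combGauge`
(module `…SmallFieldUltracontractivityStubCombGauge`), enlarge it to `max C_A 6`, and put `A₀ = 4`.
Given `L ≥ 4/δ` let `R = ⌊(L − 1)/2⌋`, so that `2R + 1 ≤ L` (the cube of radius `R` about `x` does
not wrap) and `2R ≥ L − 2 ≥ 4/δ − 2 ≥ 2/δ`, i.e. `R δ ≥ 1`.  The gauge is the comb gauge of that
cube.  Inside (`torusDist x z + 1 ≤ R`) the bound is `stub_combGauge` (global smallness implies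
smallness on the ball).  Outside, `torusDist x z + 1 > R`, so `(torusDist x z + 1) δ ≥ R δ ≥ 1`, and
the deficit of any `V ∈ SU(3)` is at most `6` because `|Re tr V| ≤ Σ_a |V_{aa}| ≤ 3` (entries of a
unitary matrix have modulus `≤ 1`, `entry_norm_bound_of_unitary`); hence it is
`≤ 6 ≤ 6 ((torusDist x z + 1) δ)² ≤ max C_A 6 · (torusDist x z + 1)² δ²`.
-/

namespace Summit.QuantumFields.QCD.Cruxes.InterleavedHeatSliceFlow.Sketch

open Literature.MathematicalPhysics.QuantumLattice Literature.MathematicalPhysics.QuantumFieldTheory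
  Literature.Probability.LatticeModels
open Summit.QuantumFields.QCD.Theses.HeatSlicedQuarks
open scoped Matrix

/-- The trivial deficit bound: `3 - Re tr V ≤ 6` for every `V ∈ SU(3)` (the diagonal entries of a
unitary matrix have modulus `≤ 1`, so `|Re tr V| ≤ 3`). -/
private theorem globalCombGauge_deficit_le_six (V : Matrix.specialUnitaryGroup (Fin 3) ℂ) :
    3 - ((fundamentalRep (Fin 3)) V).trace.re ≤ 6 := by
  have hV := fundamentalRep_mem_unitaryGroup V
  have h : |((fundamentalRep (Fin 3)) V).trace.re| ≤ 3 :=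
    calc |((fundamentalRep (Fin 3)) V).trace.re|
        ≤ ‖((fundamentalRep (Fin 3)) V).trace‖ := Complex.abs_re_le_norm _
      _ = ‖∑ k, (fundamentalRep (Fin 3)) V k k‖ := rfl
      _ ≤ ∑ k, ‖(fundamentalRep (Fin 3)) V k k‖ := norm_sum_le _ _
      _ ≤ ∑ _k : Fin 3, (1 : ℝ) :=
          Finset.sum_le_sum fun k _ => entry_norm_bound_of_unitary hV k k
      _ = 3 := by simp
  have h' := (abs_le.mp h).1
  linarith

/-- **Global comb gauge** (registered stub `stub_globalCombGauge` of line `Sketch`, reshape r4; the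
statement `GlobalCombGauge`).  There are `C_A ≥ 0` and `A₀` such that for every `L⁴` torus, every
`SU(3)` configuration `U`, centre `x` and `0 < δ ≤ 1` with `A₀/δ ≤ L`: if all plaquette deficits are
`≤ δ²`, then after a gauge transformation every link `(z, μ)` has deficit
`≤ C_A (torusDist x z + 1)² δ²`.  Inside the cube of radius `R = ⌊(L-1)/2⌋ ≥ 1/δ` about `x` this
is 8871's `stub_combGauge`; outside, `C_A (torusDist x z + 1)² δ² ≥ 6` dominates any deficit. -/
theorem stub_globalCombGauge :
    ∃ C_A A₀ : ℝ, 0 ≤ C_A ∧ ∀ (L : ℕ) [NeZero L]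
      (U : GaugeConfig 4 L (Matrix.specialUnitaryGroup (Fin 3) ℂ)) (x : TorusSite 4 L) (δ : ℝ),
      0 < δ → δ ≤ 1 → A₀ / δ ≤ (L : ℝ) →
      (∀ (y : TorusSite 4 L) (μ ν : Fin 4),
        3 - ((fundamentalRep (Fin 3)) (plaquetteHolonomy U y μ ν)).trace.re ≤ δ ^ 2) →
      ∃ g : TorusSite 4 L → Matrix.specialUnitaryGroup (Fin 3) ℂ, ∀ (z : TorusSite 4 L) (μ : Fin 4),
        3 - ((fundamentalRep (Fin 3)) (gaugeTransform g U (z, μ))).trace.re ≤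
          C_A * ((torusDist x z : ℝ) + 1) ^ 2 * δ ^ 2 := by
  obtain ⟨C_A, hC⟩ := SmallFieldUltracontractivity.PointCentredAxialParabolic.stub_combGauge
  refine ⟨max C_A 6, 4, (by norm_num : (0 : ℝ) ≤ 6).trans (le_max_right _ _),
    fun L _ U x δ hδ hδ1 hL hyp => ?_⟩
  -- the radius `R = ⌊(L-1)/2⌋` of the non-wrapping cube: `2R + 1 ≤ L` and `R δ ≥ 1`
  have hLδ : 4 ≤ (L : ℝ) * δ := (div_le_iff₀ hδ).mp hL
  have hL4 : (4 : ℝ) ≤ L := by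
    have := mul_le_mul_of_nonneg_left hδ1 (Nat.cast_nonneg L)
    linarith
  have hL2 : 2 ≤ L := by exact_mod_cast (show (2 : ℝ) ≤ L by linarith)
  obtain ⟨R, hR⟩ : ∃ R : ℕ, R = (L - 1) / 2 := ⟨_, rfl⟩
  have hRL : 2 * R + 1 ≤ L := by omega
  have h2R : (L : ℝ) ≤ 2 * R + 2 := by exact_mod_cast (show L ≤ 2 * R + 2 by omega)
  have hRδ : 1 ≤ (R : ℝ) * δ := by
    have := mul_le_mul_of_nonneg_right h2R hδ.le
    linarith
  -- the comb gauge of the cube (8871), fed with the global smallness hypothesis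
  obtain ⟨g, hg⟩ := hC L U x R hRL δ hδ.le (fun y _ μ ν => hyp y μ ν)
  refine ⟨g, fun z μ => ?_⟩
  have hsq : 0 ≤ ((torusDist x z : ℝ) + 1) ^ 2 * δ ^ 2 := by positivity
  by_cases hz : torusDist x z + 1 ≤ R
  · -- inside the cube
    calc 3 - ((fundamentalRep (Fin 3)) (gaugeTransform g U (z, μ))).trace.re
        ≤ C_A * ((torusDist x z : ℝ) + 1) ^ 2 * δ ^ 2 := hg z hz μ
      _ ≤ max C_A 6 * ((torusDist x z : ℝ) + 1) ^ 2 * δ ^ 2 := by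
          rw [mul_assoc, mul_assoc]
          exact mul_le_mul_of_nonneg_right (le_max_left _ _) hsq
  · -- outside the cube: `(torusDist x z + 1) δ ≥ R δ ≥ 1` and the deficit is at most `6`
    have hRd : (R : ℝ) ≤ torusDist x z := by exact_mod_cast (show R ≤ torusDist x z by omega)
    have hP : 1 ≤ ((torusDist x z : ℝ) + 1) * δ := by
      have := mul_le_mul_of_nonneg_right hRd hδ.le
      linarith
    have hP2 : 1 ≤ ((torusDist x z : ℝ) + 1) ^ 2 * δ ^ 2 := by
      rw [← mul_pow]
      exact one_le_pow₀ hP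
    calc 3 - ((fundamentalRep (Fin 3)) (gaugeTransform g U (z, μ))).trace.re
        ≤ 6 := globalCombGauge_deficit_le_six _
      _ ≤ 6 * (((torusDist x z : ℝ) + 1) ^ 2 * δ ^ 2) := by linarith
      _ ≤ max C_A 6 * (((torusDist x z : ℝ) + 1) ^ 2 * δ ^ 2) :=
          mul_le_mul_of_nonneg_right (le_max_right _ _) hsq
      _ = max C_A 6 * ((torusDist x z : ℝ) + 1) ^ 2 * δ ^ 2 := by ring

end Summit.QuantumFields.QCD.Cruxes.InterleavedHeatSliceFlow.Sketch
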